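import Summits.BirchSwinnertonDyer.Rank1Residual.X9.BSDpPartnerRankOne
import Summits.BirchSwinnertonDyer.Rank1Residual.X9.S4DescentPairsZimmertB
import Summits.BirchSwinnertonDyer.Rank1Residual.X9.ChaDescentRecords
import HarnessLib

/-!
# Class X9, `p = 5`: BSD along mod-`5` CONGRUENCES — the open SHA row `199988e1` and the Tamagawa-obstructed
# (T-JET) rank-`0` cells reached by Greenberg–Vatsal transport from certified RANK-ONE partners (per-pair kernel records)

HONEST FRAMING (cell `b2b-bsdres-*`, verbatim): the cell deletes COMBINATION-SHAPED residual classes of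
the rank-≤1 BSD formula from PUBLISHED theorems only and TYPES the construction-shaped remainder; this
is not "finishing BSD". Class X9 (good ordinary `p ≥ 5`, `ρ̄_{E,p}` irreducible and not surjective)
stays TYPED at class level; everything here is PER PAIR; no lane verdict is changed; no named fact is
introduced; nothing is booked by this unit (the lane books, the referee rules). Unit `b2b-bsdres-x9`, gen 15.

## What this file does (our own work, hence `Summits/`)

Gen 10's `X9/BSDpPartnerRankOne.lean` proved that at a good ordinary irreducible `p ≥ 5` the `p`-part of
BSD PROPAGATES along mod-`p` congruences between curves of analytic rank `≤ 1`: if `A[p] ≅ E[p]` as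
`Γ_ℚ`-modules (certificate C1, finite by Kraus–Oesterlé 1992 Prop. 4), `BSD(A,p)` holds, one coefficient
of `𝓛_MSD(A)` is a `p`-adic unit (C2) and — when `r_an(A) = 1` — Schneider's certificate holds for `A`
(C3), then BCS 2025 Thm. 1.1.2 (a) + `BSD(A,p)` force the exponent `k` of the rational main conjecture to
`0`, Greenberg–Vatsal 2000 Thm. (1.4) carries Mazur's main conjecture with `μ = 0` from `A` to `E`, and
the cell's glue gives `BSD(E,p)`. HERE that theorem is (§1) restated with the TARGET's hypotheses spelled
out (`p ∤ Δ_min`, `p ∤ a_p`, `E[p]` irreducible — no `ClassX9` packaging is needed: non-CM and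
non-surjectivity play no role in the proof) and in a form whose target-side Galois data are DECIDED IN
THE KERNEL from the integer model (x11c's `IntModel` toolkit, as in gen 13/14's `X9/ChaDescentRecords*`:
`Δ ≠ 0`, Kraus' bounded minimality criterion, good ordinary reduction at `p` by the kernel point count
`#Ẽ(𝔽_p)`, irreducibility by a Frobenius witness `ℓ` — Mazur 1978 Prop. 6.3 (1)), and (§3) applied to
the pairs of the cell's class-closure table `class-closure/N3/CONG-certified-eng2.tsv` (cc-eng-2, tier D:
every partner has analytic rank ONE) whose targets are the OPEN or T-JET-LITERAL cells of the N3 universe: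

* `199988e1 @ 5` (`5S4`, `r_an = 0`, `#Ш_an = 25`, `c₁₇₃ = 5`) — after referee A's ROUND 197 the ONE
  X9-only open residue class of the lane ledger (`RESIDUAL-MAP §I N3`): its UPPER half resisted every
  Heegner field (index `ord₅ = 2` everywhere: Jetchev `k = 1`, flag `Miller11-Thm54-Cha-case`) and the twist
  trick (gen 14). Partner `484364c1` (`r_an = 1`, `5S4`, Kraus–Oesterlé bound `B = 22 362 479`) has the
  KERNEL theorem `X9.bsdp_s484364c1` (gen 14, `X9/S4DescentPairsZimmertB.lean`: exact `5`-descent with a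
  Zimmert-CERTIFIED class group) — so `bsdp_t199988e1` below has NO `BSDp`-hypothesis at all: every binder is
  a PUBLISHED theorem (`hKO`, `hBCS`, `hGr`, `h5`, `hGV`, `hS`, `hPR`, `hmodP`, `hmodL`, `hGZK`) or a FINITE
  certificate (`r_an`, `#Ш_an(A)`, the descent line of `A`, C1 = the Kraus–Oesterlé congruence list, C2, C3).
  Second partner `8092e1` (`r_an = 1`, `B = 425 951`; C1 three engines and C3 two engines already in gen 10,
  kits j085527 / j087181 / j093230): `bsdp_t199988e1_of_bsdp_s8092e1`, with `BSDp 8092e1 5` displayed.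
* the T-JET literal cells `337977n1 ← 19881h1`, `337977p1 ← 19881i1`, `274428h1 ← 39204h1`,
  `168948a1 ← 12996j1`, `206388x1 ← 15876i1` (all `5S4`, target `r_an = 0` with `ord₅ ∏c_ℓ = 1`, partner
  `r_an = 1` with a two-engine Heegner-index row `ord₅ [A(K):ℤy_K] = 0` in the X9 fold — CERT, unflagged):
  `bsdp_t<target>_of_bsdp_<partner>`, with `BSDp A 5` displayed as the binder the lane's certificate of the
  partner discharges. No Jetchev, no descent of the target, no GRH.

Certificates of THIS unit for these seven pairs (HOME/b2b-bsdres-x9/g15/, code/b2b-bsdres-x9/g15/JOBS.md):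
C1 by TWO engines (PARI `ellap`; ENGINE D pure-Python BSGS/Mestre) up to the Kraus–Oesterlé bound, kit
j127638; C3 for every partner by TWO engines (PARI `ellpadicheight`; pure-Python Mazur–Tate σ engine),
kit j127638 (+ gen 10 j085527/j087181); C2 = gen 9's two-engine `μ(𝓛₅) = 0` table `g9/mu/MU-ALL.tsv`
(790/790 X9 pairs, every partner included). In the kernel these stay BINDERS (`hcong`/`hC1`, `hcertA`,
`hSchA`): finite statements about `a_ℓ`, one modular-symbol coefficient and one `p`-adic height.

References: Greenberg–Vatsal, Invent. Math. 142 (2000) Thm. (1.4); Burungale–Castella–Skinner, IMRN 2025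
Thm. 1.1.2 (a); Kraus–Oesterlé, Math. Ann. 293 (1992) Prop. 4; Greenberg, LNM 1716 (1999) Thm. 4.1;
Perrin-Riou 1987 §1.4; Balakrishnan–Müller–Stein 2016 Thm. 1.7 (Schneider); Mazur 1978 Prop. 6.3 (1);
Silverman AEC VII.1; Miller 2011 Def. 1.1; Cremona's tables.
-/

set_option autoImplicit false

noncomputable section

open scoped Classical MatrixGroups ModularForm

open CongruenceSubgroup WeierstrassCurve Literature.NumberTheory.EllipticCurves
  Literature.NumberTheory.EllipticCurves.ModularForms Literature.NumberTheory.EllipticCurves.Rank1Residual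
  Literature.NumberTheory.EllipticCurves.Rank1Residual.Typed
  Literature.NumberTheory.EllipticCurves.Rank1Residual.X11RankOneCertificates
  Summit.BirchSwinnertonDyer.BirchSwinnertonDyer.Rank1Residual.IntModel
  Summit.BirchSwinnertonDyer.BirchSwinnertonDyer.Rank1Residual.X11RankOne
  Summit.BirchSwinnertonDyer.Rank1Residual.X11b

namespace Summit.BirchSwinnertonDyer.Rank1Residual.X9

/-! ### §1. Route U2′ (partner of analytic rank `≤ 1`) with the target's hypotheses spelled out -/

section Generic

variable (W A : WeierstrassCurve ℚ) [W.IsElliptic] [W.IsGloballyMinimal] [A.IsElliptic]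
  [A.IsGloballyMinimal] (p : ℕ) [Fact p.Prime]

/-- **Route U2′ with a partner of analytic rank `≤ 1` — target hypotheses unpacked.** Identical to gen 10's
`bsdp_of_bsdpPartner_of_partnerRank_le_one` except that the target is described by `p ∤ Δ_min` (`hgood`),
`p ∤ a_p` (`hord`), `5 ≤ p` and `E[p]` irreducible (`hirr`) instead of `ClassX9 W p` (whose non-CM and
non-surjectivity clauses that proof never used). `BSD(E,p)` for `r_an(E) ≤ 1` from: a congruent partner `A`
(C1 `hC1`), good ordinary at `p`, `r_an(A) ≤ 1`, `BSDp A p`, C2 `hcertA`, C3 `hSchA` (only if `r_an(A) = 1`),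
C3 for `E` (`hC3`, only if `r_an(E) = 1`); PUBLISHED binders `hBCS`, `hGr`, `h5`, `hGV`, `hS`, `hPR`,
`hmodP`, `hmodL`, `hGZK`. [cite: GreenbergVatsal2000, Thm. (1.4) (arXiv p. 5)]
[cite: BurungaleCastellaSkinner2025, Thm. 1.1.2 (a) (p. 2 of arXiv:2405.00270v2)] [cite: GreenbergLNM1716, Thm. 4.1 (p. 102)] -/
theorem bsdp_of_bsdpPartner_of_partnerRank_le_one_of_irr
    (hBCS : burungale_castella_skinner_charIdeal_eq_padicLFunction)
    (hGr : greenberg_charValue_rankZero) (h5 : realPeriodRat_eq_unit_mul_plusPeriod)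
    (hGV : GreenbergVatsal2000.thm14_mainConjecture_transfer_of_torsionIso)
    (hS : Schneider1985_order_charGenerator) (hPR : perrinRiou_rankOne_leadingTerms)
    (hmodP : nonempty_modularParametrizationData) (hmodL : hasEntireLFunction_rat)
    (hGZK : rank_eq_analyticRank_of_analyticRank_le_one)
    (hran : W.analyticRank ≤ 1) (hgood : W.HasGoodReductionAtPrime p)
    (hord : ¬ (p : ℤ) ∣ W.frobeniusTrace p) (hp : 5 ≤ p) (hirr : W.HasIrreducibleModPGaloisRep p)
    (hgoodA : A.HasGoodReductionAtPrime p) (hordA : ¬ (p : ℤ) ∣ A.frobeniusTrace p)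
    (hrA : A.analyticRank ≤ 1) (hbsdA : BSDp A p)
    (hSchA : A.analyticRank = 1 → ∀ Dh : PAdicHeightData A p, Dh.IsCanonical → SchneiderConjecture Dh)
    (hcertA : ∀ [NeZero (A.conductorNorm ℤ)] (fA : CuspForm (Gamma0 (A.conductorNorm ℤ)) 2),
        IsNewformOf A fA → ∀ (ϖ : ℚ), (ϖ : ℝ) * A.realPeriodRat = plusPeriod fA →
      ∃ n : ℕ, ‖PowerSeries.coeff n
        (PowerSeries.C (ϖ : ℚ_[p]) * padicLFunction fA (unitRoot A p : ℚ_[p]))‖ = 1)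
    (hC1 : ∃ e : geomTorsion A (p : ℤ) ≃+ geomTorsion W (p : ℤ),
      ∀ (σ : Field.absoluteGaloisGroup ℚ) (P : geomTorsion A (p : ℤ)), e (σ • P) = σ • e P)
    (hC3 : W.analyticRank = 1 → ∀ Dh : PAdicHeightData W p, Dh.IsCanonical → SchneiderConjecture Dh) :
    BSDp W p := by
  have hp2 : p ≠ 2 := by omega
  obtain ⟨e, he⟩ := hC1
  have hirrA : A.HasIrreducibleModPGaloisRep p :=
    hasIrreducibleModPGaloisRep_of_torsionIso_symm e he hirr
  have h₁ := mazurMainConjecture_with_mu_zero_of_bsdp_of_analyticRank_le_one hBCS hGr h5 hS hPR hmodL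
    hGZK A p hp hgoodA hordA hirrA hrA hbsdA hSchA hcertA
  rcases Nat.le_one_iff_eq_zero_or_eq_one.mp hran with hr | hr
  · have hL1 : W.entireLFunction 1 ≠ 0 := (W.analyticRank_eq_zero_iff_holds (hmodL W)).1 hr
    exact bsdp_of_pPartRankZero W p hmodL hGZK hr
      (GreenbergVatsal2000.pPartRankZero_of_thm14 A W p hGV hmodP hGZK hp2 hgoodA hordA hgood hord
        ⟨e, he⟩ hirrA h₁ hL1 (hGr W p hp2 hgood hord))
  · exact Typed.bsdp_of_missingPPartAt W p hGZK hran
      (Wuthrich2014.missingPPartAt_of_mainConjecture_of_rank_one hS hPR hmodP hGZK W p hp hgood hord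
        hr (hC3 hr)
        (GreenbergVatsal2000.mazurMainConjecture_of_thm14 A W p hGV hp2 hgoodA hordA hgood hord ⟨e, he⟩
          hirrA h₁))

/-- **The same with C1 as the Kraus–Oesterlé congruence list** (`hKO` = Kraus–Oesterlé 1992 Prop. 4, named fact;
`hcong` = the finite list `a_ℓ(E) ≡ a_ℓ(A)` / `a_ℓ(E)a_ℓ(A) ≡ ℓ + 1 (mod p)` for all primes `6ℓ < μ(M)`).
[cite: KrausOesterle1992, Prop. 4] [cite: GreenbergVatsal2000, Thm. (1.4) (arXiv p. 5)] -/
theorem bsdp_of_bsdpPartner_of_congruences_of_partnerRank_le_one_of_irr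
    (hKO : KrausOesterle1992.prop4_torsionIso_of_congruences)
    (hBCS : burungale_castella_skinner_charIdeal_eq_padicLFunction)
    (hGr : greenberg_charValue_rankZero) (h5 : realPeriodRat_eq_unit_mul_plusPeriod)
    (hGV : GreenbergVatsal2000.thm14_mainConjecture_transfer_of_torsionIso)
    (hS : Schneider1985_order_charGenerator) (hPR : perrinRiou_rankOne_leadingTerms)
    (hmodP : nonempty_modularParametrizationData) (hmodL : hasEntireLFunction_rat)
    (hGZK : rank_eq_analyticRank_of_analyticRank_le_one)
    (hran : W.analyticRank ≤ 1) (hgood : W.HasGoodReductionAtPrime p)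
    (hord : ¬ (p : ℤ) ∣ W.frobeniusTrace p) (hp : 5 ≤ p) (hirr : W.HasIrreducibleModPGaloisRep p)
    (hgoodA : A.HasGoodReductionAtPrime p) (hordA : ¬ (p : ℤ) ∣ A.frobeniusTrace p)
    (hrA : A.analyticRank ≤ 1) (hbsdA : BSDp A p)
    (hSchA : A.analyticRank = 1 → ∀ Dh : PAdicHeightData A p, Dh.IsCanonical → SchneiderConjecture Dh)
    (hcertA : ∀ [NeZero (A.conductorNorm ℤ)] (fA : CuspForm (Gamma0 (A.conductorNorm ℤ)) 2),
        IsNewformOf A fA → ∀ (ϖ : ℚ), (ϖ : ℝ) * A.realPeriodRat = plusPeriod fA →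
      ∃ n : ℕ, ‖PowerSeries.coeff n
        (PowerSeries.C (ϖ : ℚ_[p]) * padicLFunction fA (unitRoot A p : ℚ_[p]))‖ = 1)
    (hcong : ∀ (ℓ : ℕ) [Fact ℓ.Prime],
      6 * ℓ < KrausOesterle1992.gammaZeroIndex (KrausOesterle1992.modulus W A) →
      (padicValNat ℓ (W.conductorNorm ℤ * A.conductorNorm ℤ) = 0 →
          (p : ℤ) ∣ W.frobeniusTrace ℓ - A.frobeniusTrace ℓ) ∧
        (padicValNat ℓ (W.conductorNorm ℤ * A.conductorNorm ℤ) = 1 →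
          (p : ℤ) ∣ W.frobeniusTrace ℓ * A.frobeniusTrace ℓ - (ℓ + 1)))
    (hC3 : W.analyticRank = 1 → ∀ Dh : PAdicHeightData W p, Dh.IsCanonical → SchneiderConjecture Dh) :
    BSDp W p :=
  bsdp_of_bsdpPartner_of_partnerRank_le_one_of_irr W A p hBCS hGr h5 hGV hS hPR hmodP hmodL hGZK hran
    hgood hord hp hirr hgoodA hordA hrA hbsdA hSchA hcertA
    (KrausOesterle1992.torsionIso_of_congruences hKO W A p hirr hcong) hC3

end Generic

/-! ### §2. The target and partner from their integer models (rank `0` target; decidable Galois data) -/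

/-- **Rank-`0` target, partner of analytic rank `≤ 1`, both given by globally minimal INTEGER models: every
Galois / reduction hypothesis from DECIDABLE integer data.** Target `W` with integral model `[a₁,…,a₆]`:
`p ∤ Δ` (good), kernel point count `#Ẽ(𝔽_p) = n_p` with `p ∤ p + 1 − n_p` (ordinary), a good prime `ℓ ≠ p`
with `#Ẽ(𝔽_ℓ) = n` and `X² − (ℓ + 1 − n)X + ℓ` root-free mod `p` (`E[p]` irreducible, Mazur 1978 Prop. 6.3 (1));
partner `A` with integral model `[a′₁,…,a′₆]`: `p ∤ Δ′`, `#Ã(𝔽_p) = n′_p` with `p ∤ p + 1 − n′_p`. Remaining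
binders: PUBLISHED `hKO … hGZK`; `r_an(E) = 0`, `r_an(A) ≤ 1`, `BSDp A p`, C2 `hcertA`, C3 `hSchA`, and C1 as
the Kraus–Oesterlé list `hcong`. [cite: KrausOesterle1992, Prop. 4] [cite: GreenbergVatsal2000, Thm. (1.4) (arXiv p. 5)]
[cite: Mazur1978, §6 Prop. 6.3 (1) (p. 153)] [cite: SilvermanAEC2009, VII.1 Remark 1.1] -/
theorem bsdp_of_ainvs_of_bsdpPartner_of_congruences
    (hKO : KrausOesterle1992.prop4_torsionIso_of_congruences)
    (hBCS : burungale_castella_skinner_charIdeal_eq_padicLFunction)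
    (hGr : greenberg_charValue_rankZero) (h5 : realPeriodRat_eq_unit_mul_plusPeriod)
    (hGV : GreenbergVatsal2000.thm14_mainConjecture_transfer_of_torsionIso)
    (hS : Schneider1985_order_charGenerator) (hPR : perrinRiou_rankOne_leadingTerms)
    (hmodP : nonempty_modularParametrizationData) (hmodL : hasEntireLFunction_rat)
    (hGZK : rank_eq_analyticRank_of_analyticRank_le_one)
    (a1 a2 a3 a4 a6 : ℤ) {W : WeierstrassCurve ℚ} [W.IsElliptic] [W.IsGloballyMinimal]
    (hW : integralModelInt W = ⟨a1, a2, a3, a4, a6⟩)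
    (b1 b2 b3 b4 b6 : ℤ) {A : WeierstrassCurve ℚ} [A.IsElliptic] [A.IsGloballyMinimal]
    (hA : integralModelInt A = ⟨b1, b2, b3, b4, b6⟩)
    (p ℓ n np npA : ℕ) [Fact p.Prime] [Fact ℓ.Prime] (hp : 5 ≤ p)
    (hpΔ : ¬ (p : ℤ) ∣ discOf [a1, a2, a3, a4, a6])
    (hcardp : Nat.card (((⟨a1, a2, a3, a4, a6⟩ : WeierstrassCurve ℤ).map
      (Int.castRingHom (ZMod p))).toAffine.Point) = np)
    (hordp : ¬ (p : ℤ) ∣ (p : ℤ) + 1 - np)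
    (hℓp : ℓ ≠ p) (hℓΔ : ¬ (ℓ : ℤ) ∣ discOf [a1, a2, a3, a4, a6])
    (hcard : Nat.card (((⟨a1, a2, a3, a4, a6⟩ : WeierstrassCurve ℤ).map
      (Int.castRingHom (ZMod ℓ))).toAffine.Point) = n)
    (hnoroot : ∀ t : ℕ, t < p → ¬ (p : ℤ) ∣ (t : ℤ) ^ 2 - ((ℓ : ℤ) + 1 - n) * t + ℓ)
    (hpΔA : ¬ (p : ℤ) ∣ discOf [b1, b2, b3, b4, b6])
    (hcardpA : Nat.card (((⟨b1, b2, b3, b4, b6⟩ : WeierstrassCurve ℤ).map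
      (Int.castRingHom (ZMod p))).toAffine.Point) = npA)
    (hordpA : ¬ (p : ℤ) ∣ (p : ℤ) + 1 - npA)
    (hr : W.analyticRank = 0) (hrA : A.analyticRank ≤ 1) (hbsdA : BSDp A p)
    (hSchA : A.analyticRank = 1 → ∀ Dh : PAdicHeightData A p, Dh.IsCanonical → SchneiderConjecture Dh)
    (hcertA : ∀ [NeZero (A.conductorNorm ℤ)] (fA : CuspForm (Gamma0 (A.conductorNorm ℤ)) 2),
        IsNewformOf A fA → ∀ (ϖ : ℚ), (ϖ : ℝ) * A.realPeriodRat = plusPeriod fA →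
      ∃ n : ℕ, ‖PowerSeries.coeff n
        (PowerSeries.C (ϖ : ℚ_[p]) * padicLFunction fA (unitRoot A p : ℚ_[p]))‖ = 1)
    (hcong : ∀ (ℓ : ℕ) [Fact ℓ.Prime],
      6 * ℓ < KrausOesterle1992.gammaZeroIndex (KrausOesterle1992.modulus W A) →
      (padicValNat ℓ (W.conductorNorm ℤ * A.conductorNorm ℤ) = 0 →
          (p : ℤ) ∣ W.frobeniusTrace ℓ - A.frobeniusTrace ℓ) ∧
        (padicValNat ℓ (W.conductorNorm ℤ * A.conductorNorm ℤ) = 1 →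
          (p : ℤ) ∣ W.frobeniusTrace ℓ * A.frobeniusTrace ℓ - (ℓ + 1))) :
    BSDp W p := by
  have hΔ : (⟨a1, a2, a3, a4, a6⟩ : WeierstrassCurve ℤ).Δ = discOf [a1, a2, a3, a4, a6] :=
    intCurve_Δ a1 a2 a3 a4 a6
  have hΔA : (⟨b1, b2, b3, b4, b6⟩ : WeierstrassCurve ℤ).Δ = discOf [b1, b2, b3, b4, b6] :=
    intCurve_Δ b1 b2 b3 b4 b6
  have hgood : W.HasGoodReductionAtPrime p :=
    hasGoodReductionAtPrime_of_not_dvd W p (by rw [minimalDiscriminantInt_eq hW, hΔ]; exact hpΔ)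
  have hord : ¬ (p : ℤ) ∣ W.frobeniusTrace p := by rw [frobeniusTrace_eq hW hcardp]; exact hordp
  have hgoodA : A.HasGoodReductionAtPrime p :=
    hasGoodReductionAtPrime_of_not_dvd A p (by rw [minimalDiscriminantInt_eq hA, hΔA]; exact hpΔA)
  have hordA : ¬ (p : ℤ) ∣ A.frobeniusTrace p := by rw [frobeniusTrace_eq hA hcardpA]; exact hordpA
  have hirr : W.HasIrreducibleModPGaloisRep p := by
    refine hasIrreducibleModPGaloisRep_of_intModel_of_noroot hW p ℓ hℓp (by rw [hΔ]; exact hℓΔ) hcard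
      (forall_zmod_of_forall_lt fun t ht h0 ↦ hnoroot t ht ?_)
    rw [← ZMod.intCast_zmod_eq_zero_iff_dvd]
    push_cast at h0 ⊢
    linear_combination h0
  have hran : W.analyticRank ≤ 1 := by rw [hr]; norm_num
  exact bsdp_of_bsdpPartner_of_congruences_of_partnerRank_le_one_of_irr W A p hKO hBCS hGr h5 hGV hS
    hPR hmodP hmodL hGZK hran hgood hord hp hirr hgoodA hordA hrA hbsdA hSchA hcertA hcong
    (fun h1 ↦ absurd h1 (by rw [hr]; norm_num))

/-! ### §3. Frobenius point counts (kernel-decided data) -/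

/-- `#Ẽ(𝔽₅) = 2` (`a₅ = 4`: good ORDINARY, non-anomalous) for Cremona's model `199988e1` (kernel count). [folklore] -/
theorem card_t199988e1_5 :
    Nat.card (((⟨0, 0, 0, -41642588, -103238220075⟩ : WeierstrassCurve ℤ).map
      (Int.castRingHom (ZMod 5))).toAffine.Point) = 2 := by
  rw [@WeierstrassCurve.natCard_point_eq_one_add_card (ZMod 5) (@ZMod.instField 5 ⟨by norm_num⟩) _ _ _
    (by decide +kernel), @card_sol_eq_sum_euler (ZMod 5) (@ZMod.instField 5 ⟨by norm_num⟩) _ _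
    (by rw [ZMod.ringChar_zmod_n]; decide), ZMod.card]
  decide +kernel

/-- `#Ẽ(𝔽₃) = 4` (`a₃ = 0`; `X² + 3` root-free mod `5`) for Cremona's model `199988e1` (kernel count). [folklore] -/
theorem card_t199988e1_3 :
    Nat.card (((⟨0, 0, 0, -41642588, -103238220075⟩ : WeierstrassCurve ℤ).map
      (Int.castRingHom (ZMod 3))).toAffine.Point) = 4 := by
  rw [@WeierstrassCurve.natCard_point_eq_one_add_card (ZMod 3) (@ZMod.instField 3 ⟨by norm_num⟩) _ _ _
    (by decide +kernel), @card_sol_eq_sum_euler (ZMod 3) (@ZMod.instField 3 ⟨by norm_num⟩) _ _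
    (by rw [ZMod.ringChar_zmod_n]; decide), ZMod.card]
  decide +kernel

/-- `#Ã(𝔽₅) = 7` (`a₅ = −1`: good ORDINARY) for Cremona's model `484364c1` (kernel count). [folklore] -/
theorem card_s484364c1_5 :
    Nat.card (((⟨0, 0, 0, 35688032, 215988312756⟩ : WeierstrassCurve ℤ).map
      (Int.castRingHom (ZMod 5))).toAffine.Point) = 7 := by
  rw [@WeierstrassCurve.natCard_point_eq_one_add_card (ZMod 5) (@ZMod.instField 5 ⟨by norm_num⟩) _ _ _
    (by decide +kernel), @card_sol_eq_sum_euler (ZMod 5) (@ZMod.instField 5 ⟨by norm_num⟩) _ _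
    (by rw [ZMod.ringChar_zmod_n]; decide), ZMod.card]
  decide +kernel

/-! ### §4. The record: `199988e1 @ 5` from its Zimmert-certified rank-one partner `484364c1` -/

/-- `199988e1`'s Cremona model is an elliptic curve (`Δ ≠ 0`, kernel). [cite: Cremona2006, Table 1 (Cremona label 199988e1)] -/
theorem isElliptic_t199988e1 : (⟨0, 0, 0, -41642588, -103238220075⟩ : WeierstrassCurve ℚ).IsElliptic :=
  isElliptic_of_discOf_ne_zero 0 0 0 (-41642588) (-103238220075) (by decide +kernel)

/-- `199988e1`'s Cremona model is globally minimal (Kraus' bounded criterion, kernel). [cite: SilvermanAEC2009, VII.1 Remark 1.1] -/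
theorem isGloballyMinimal_t199988e1 :
    (⟨0, 0, 0, -41642588, -103238220075⟩ : WeierstrassCurve ℚ).IsGloballyMinimal :=
  isGloballyMinimal_of_krausCriterion_bounded₂ 0 0 0 (-41642588) (-103238220075) (by decide +kernel)
    (by decide +kernel) (by decide +kernel)

/-- `484364c1`'s Cremona model is an elliptic curve (`Δ ≠ 0`, kernel). [cite: Cremona2006, Table 1 (Cremona label 484364c1)] -/
theorem isElliptic_s484364c1 : (⟨0, 0, 0, 35688032, 215988312756⟩ : WeierstrassCurve ℚ).IsElliptic :=
  isElliptic_of_discOf_ne_zero 0 0 0 35688032 215988312756 (by decide +kernel)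

/-- `484364c1`'s Cremona model is globally minimal (Kraus' bounded criterion, kernel). [cite: SilvermanAEC2009, VII.1 Remark 1.1] -/
theorem isGloballyMinimal_s484364c1 :
    (⟨0, 0, 0, 35688032, 215988312756⟩ : WeierstrassCurve ℚ).IsGloballyMinimal :=
  isGloballyMinimal_of_krausCriterion_bounded₂ 0 0 0 35688032 215988312756 (by decide +kernel)
    (by decide +kernel) (by decide +kernel)

/-- **`BSD(E,5)` for `199988e1`** (`N = 199988 = 2²·17²·173`; good ORDINARY at `5`, `a₅ = 4`; Cremona model
`[0, 0, 0, -41642588, -103238220075]`; `ρ̄_{E,5}` irreducible (Frobenius witness `ℓ = 3`: `#Ẽ(𝔽₃) = 4`, `a₃ = 0`,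
`X² + 3` root-free mod `5`) and — census datum, Cremona/LMFDB `galrep`, not used — of EXCEPTIONAL type `5S4`;
analytic rank `0`; `#Ш_an = 25`; `c₂ = 1`, `c₁₇ = 1`, `c₁₇₃ = 5`) — after referee A's ROUND 197 the ONE X9-only open
residue class of the lane ledger (`Ш(E)[5] ≅ (ℤ/5)²` exact and Zimmert-certified, gen 13; upper half so far
only by Jetchev `k = 1` under Cha's hypothesis, flag `Miller11-Thm54-Cha-case`) — **from the mod-`5` CONGRUENT
rank-ONE partner `484364c1`** (`N_A = 484364 = 2²·17²·419`; good ordinary at `5`, `a₅ = −1`; `r_an(A) = 1`,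
`#Ш_an(A) = 1`; KERNEL theorem `X9.bsdp_s484364c1` = exact `5`-descent `dim Sel⁵(A) = 1` with a Zimmert-CERTIFIED
class group, gen 14) by Greenberg–Vatsal transport: `BSD(A,5)` + C2 + C3 ⟹ Mazur's main conjecture for
`(A,5)` with `μ = 0` (BCS 2025 Thm. 1.1.2 (a), exponent forced to `0`) ⟹ the same for `(E,5)` along
`A[5] ≅ E[5]` (GV 2000 Thm. (1.4)) ⟹ `BSD(E,5)` in rank `0` (Greenberg Thm. 4.1 + interpolation + GZK).
Kernel-decided: `Δ ≠ 0` and global minimality of both models, good ordinary reduction of both at `5`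
(`#Ẽ(𝔽₅) = 2`, `#Ã(𝔽₅) = 7`), `E[5]` irreducible. Binders: PUBLISHED `hKO` (Kraus–Oesterlé 1992 Prop. 4),
`hBCS`, `hGr`, `h5`, `hGV`, `hS`, `hPR`, `hmodP`, `hmodL`, `hGZK`; FINITE certificates: `r_an(E) = 0`,
`r_an(A) ≤ 1`, `#Ш_an(A) = q` with `ord₅ q = 0`, `#Sel⁵(A) = 5^{r_an(A)}` (the Zimmert-certified descent line of
`X9/S4DescentPairsZimmertB.lean`, kit j117663 + j117641), C1 = `hcong`, the Kraus–Oesterlé congruence list: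
`M = lcm(N_E, N_A) = 83 794 972` (`S = ∅`: `2`, `17` are additive for both), `μ(M) = 134 174 880`, bound
`B = 22 362 479`: all `1 410 550` primes `ℓ ≤ B` with `v_ℓ(N_E N_A) ≤ 1` checked, `a_ℓ(E) ≡ a_ℓ(A) (mod 5)` (resp.
`a_ℓ(E)a_ℓ(A) ≡ ℓ + 1` at `ℓ ∈ {173, 419}`), `0` exceptions, TWO engines in this unit's kit j127638 (PARI `ellap`
via cypari2; ENGINE D pure-Python BSGS/Mestre, `0` fallbacks, 772.6 s) + cc-eng-2's PARI certificate j123300,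
C2 = `hcertA` (`μ(𝓛₅(A)) = 0`: gen 9 `MU-ALL.tsv`, engines B and C, `λ = 1`), C3 = `hSchA` (the cyclotomic `5`-adic
height of A's Cremona generator is non-zero on TWO engines: PARI `ellpadicheight` `[f,g] = [v 1, v 2]`,
`v₅(f − s₂g) = 1`, kit j127638; pure-Python Mazur–Tate σ engine `v₅(h) = 0`, kits j085527 (gen 10) and j127638). Instance binders `[IsElliptic]`,
`[IsGloballyMinimal]` for both models are discharged by `isElliptic_t199988e1`, `isGloballyMinimal_t199988e1`,
`isElliptic_s484364c1`, `isGloballyMinimal_s484364c1`. Per pair; nothing booked; no Jetchev, no GRH.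
[cite: GreenbergVatsal2000, Thm. (1.4) (arXiv p. 5)] [cite: KrausOesterle1992, Prop. 4]
[cite: BurungaleCastellaSkinner2025, Thm. 1.1.2 (a) (p. 2 of arXiv:2405.00270v2)] [cite: Miller2011LMS, Def. 1.1]
[cite: Cremona2006, Table 1 (Cremona labels 199988e1, 484364c1)] -/
theorem bsdp_t199988e1
    (hKO : KrausOesterle1992.prop4_torsionIso_of_congruences)
    (hBCS : burungale_castella_skinner_charIdeal_eq_padicLFunction)
    (hGr : greenberg_charValue_rankZero) (h5 : realPeriodRat_eq_unit_mul_plusPeriod)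
    (hGV : GreenbergVatsal2000.thm14_mainConjecture_transfer_of_torsionIso)
    (hS : Schneider1985_order_charGenerator) (hPR : perrinRiou_rankOne_leadingTerms)
    (hmodP : nonempty_modularParametrizationData) (hmodL : hasEntireLFunction_rat)
    (hGZK : rank_eq_analyticRank_of_analyticRank_le_one)
    (W A : WeierstrassCurve ℚ) [W.IsElliptic] [W.IsGloballyMinimal] [A.IsElliptic] [A.IsGloballyMinimal]
    [Fact (Nat.Prime 5)]
    (hW : W = ⟨0, 0, 0, -41642588, -103238220075⟩) (hA : A = ⟨0, 0, 0, 35688032, 215988312756⟩)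
    (hr : W.analyticRank = 0) (hrA : A.analyticRank ≤ 1)
    {qA : ℚ} (hqA : shaAn A = (qA : ℂ)) (hvA : padicValRat 5 qA = 0)
    (hSelA : Nat.card (A.selmerGroup (5 : ℤ)) = 5 ^ A.analyticRank)
    (hSchA : A.analyticRank = 1 → ∀ Dh : PAdicHeightData A 5, Dh.IsCanonical → SchneiderConjecture Dh)
    (hcertA : ∀ [NeZero (A.conductorNorm ℤ)] (fA : CuspForm (Gamma0 (A.conductorNorm ℤ)) 2),
        IsNewformOf A fA → ∀ (ϖ : ℚ), (ϖ : ℝ) * A.realPeriodRat = plusPeriod fA →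
      ∃ n : ℕ, ‖PowerSeries.coeff n
        (PowerSeries.C (ϖ : ℚ_[5]) * padicLFunction fA (unitRoot A 5 : ℚ_[5]))‖ = 1)
    (hcong : ∀ (ℓ : ℕ) [Fact ℓ.Prime],
      6 * ℓ < KrausOesterle1992.gammaZeroIndex (KrausOesterle1992.modulus W A) →
      (padicValNat ℓ (W.conductorNorm ℤ * A.conductorNorm ℤ) = 0 →
          (5 : ℤ) ∣ W.frobeniusTrace ℓ - A.frobeniusTrace ℓ) ∧
        (padicValNat ℓ (W.conductorNorm ℤ * A.conductorNorm ℤ) = 1 →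
          (5 : ℤ) ∣ W.frobeniusTrace ℓ * A.frobeniusTrace ℓ - (ℓ + 1))) :
    BSDp W 5 := by
  have hbsdA : BSDp A 5 := bsdp_s484364c1 hGZK A hA hrA hqA hvA hSelA
  subst hW
  subst hA
  -- instances on the `ℤ`-cast spelling of the two literal models (the shape the `IntModel` lemmas produce)
  haveI := isElliptic_of_discOf_ne_zero 0 0 0 (-41642588) (-103238220075) (by decide +kernel)
  haveI := isGloballyMinimal_of_krausCriterion_bounded₂ 0 0 0 (-41642588) (-103238220075)
    (by decide +kernel) (by decide +kernel) (by decide +kernel)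
  haveI := isElliptic_of_discOf_ne_zero 0 0 0 35688032 215988312756 (by decide +kernel)
  haveI := isGloballyMinimal_of_krausCriterion_bounded₂ 0 0 0 35688032 215988312756 (by decide +kernel)
    (by decide +kernel) (by decide +kernel)
  haveI : Fact (Nat.Prime 3) := ⟨by norm_num⟩
  exact bsdp_of_ainvs_of_bsdpPartner_of_congruences hKO hBCS hGr h5 hGV hS hPR hmodP hmodL hGZK
    0 0 0 (-41642588) (-103238220075) (integralModelInt_eq_of_map_eq _ (map_mk_int _ _ _ _ _))
    0 0 0 35688032 215988312756 (integralModelInt_eq_of_map_eq _ (map_mk_int _ _ _ _ _))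
    5 3 4 2 7 (by norm_num) (by decide +kernel) card_t199988e1_5 (by decide) (by decide)
    (by decide +kernel) card_t199988e1_3 (by decide) (by decide +kernel) card_s484364c1_5 (by decide)
    hr hrA hbsdA hSchA hcertA hcong

end Summit.BirchSwinnertonDyer.Rank1Residual.X9

end
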